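import Literature.NumberTheory.EllipticCurves.PAdicDistributionPushforward
import Literature.NumberTheory.EllipticCurves.HidaOrdinaryCohomologySymPow
import Mathlib.Algebra.MvPolynomial.Funext
import HarnessLib

/-!
# The weight-`n` specialisation of bounded distributions on `ℤ_p × ℤ_p` is `M₂`-equivariant

For a bounded `ℚ_p`-valued distribution `D` on `ℤ_p × ℤ_p` (`PAdicDistributionIntegral.lean`) and a
degree `n`, the **weight-`n` specialisation** is the coefficient vector
`D.specialize n ∈ ℚ_p^{n+1}` of the binary form

  `w = (w₀, w₁) ↦ ∫ (x w₀ + y w₁)ⁿ dD(x, y) = Σᵢ C(n,i) (∫ x^{n-i} yⁱ dD) w₀^{n-i} w₁ⁱ`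

(`evalVec_specialize`, in the coordinates `evalVec n a w = Σᵢ aᵢ w₀^{n-i} w₁ⁱ` of
`HidaOrdinaryCohomologySymPow`).  Since `((x, y)·M)·w = (x, y)·(M w)`, the change-of-variables
formula for the right action `D ↦ D·M` of `M ∈ M₂(ℤ_p)` (`PAdicDistributionPushforward.linearMap`,
`integral_linearMap`) gives **equivariance**:

  `evalVec n ((D·M).specialize n) w = evalVec n (D.specialize n) (M w)`      (`evalVec_specialize_linearMap`)
  `(D·M).specialize n = Symⁿ(M) · D.specialize n`                            (`specialize_linearMap`)

with the symmetric-power matrices `symPow n M` of `HidaOrdinaryCohomologySymPow` (whose defining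
property is `evalVec n (symPow n M a) w = evalVec n a (M w)`, `evalVec_symPow_mulVec`), and, for an
integer matrix, `(D·M).specialize n = Symⁿ(M) · D.specialize n` in the form used by the right action
`act n M` on the coefficient modules of the cocycles of `HidaOrdinaryCohomologyCocycles`
(`specialize_linearMap_intCast`).  This is the compatibility that makes distribution-valued
(`𝔻`-valued) cocycles / modular symbols specialise to `Symⁿ`-valued ones in every weight
(Greenberg–Stevens 1993, §1 (1.4)–(1.6), §4 (4.6)–(4.8); Kitagawa 1994, §5; Delbourgo 2008, §4.2).

Brick B2b of the bottom-up plan recorded with the named fact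
`greenbergStevens_kitagawa_twoVariable_interpolation_allBranches`.  Everything is proved; no named facts.

## References

* R. Greenberg, G. Stevens, Invent. Math. 111 (1993), §1, §4. [GreenbergStevens1993]
* K. Kitagawa, Contemp. Math. 165 (1994), §5. [Kitagawa1994]
* D. Delbourgo, *Elliptic Curves and Big Galois Representations* (2008), §4.2. [Delbourgo2008]
-/

noncomputable section

open Filter Topology Matrix

namespace Literature.NumberTheory.EllipticCurves

variable {p : ℕ} [Fact p.Prime]

/-! ### The pairing powers `(x w₀ + y w₁)ⁿ` -/

section PairPow

/-- The **pairing power** `(x, y) ↦ (x w₀ + y w₁)ⁿ` on `ℤ_p × ℤ_p`, for `w ∈ ℚ_p²`. [folklore] -/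
def pairPow (n : ℕ) (w : Fin 2 → ℚ_[p]) (v : ℤ_[p] × ℤ_[p]) : ℚ_[p] :=
  ((v.1 : ℚ_[p]) * w 0 + (v.2 : ℚ_[p]) * w 1) ^ n

/-- Unfolding lemma for `pairPow`. [folklore] -/
theorem pairPow_apply (n : ℕ) (w : Fin 2 → ℚ_[p]) (v : ℤ_[p] × ℤ_[p]) :
    pairPow n w v = ((v.1 : ℚ_[p]) * w 0 + (v.2 : ℚ_[p]) * w 1) ^ n := rfl

/-- `pairPow` is uniformly continuous on `ℤ_p × ℤ_p`. [folklore] -/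
theorem uniformContinuous_pairPow (n : ℕ) (w : Fin 2 → ℚ_[p]) : UniformContinuous (pairPow (p := p) n w) :=
  CompactSpace.uniformContinuous_of_continuous (by unfold pairPow; fun_prop)

/-- Monomials `x^i y^j` (as `ℚ_p`-valued functions) are uniformly continuous on `ℤ_p × ℤ_p`.
[folklore] -/
theorem uniformContinuous_coe_monomial (i j : ℕ) :
    UniformContinuous fun v : ℤ_[p] × ℤ_[p] => (v.1 : ℚ_[p]) ^ i * (v.2 : ℚ_[p]) ^ j :=
  CompactSpace.uniformContinuous_of_continuous (by fun_prop)

/-- **The matrix `(a b; c d)` over `ℚ_p`.** [folklore] -/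
def mat (a b c d : ℤ_[p]) : Matrix (Fin 2) (Fin 2) ℚ_[p] := !![(a : ℚ_[p]), (b : ℚ_[p]); (c : ℚ_[p]), (d : ℚ_[p])]

/-- `(mat a b c d) w = (a w₀ + b w₁, c w₀ + d w₁)`: first component. [folklore] -/
theorem mat_mulVec_zero (a b c d : ℤ_[p]) (w : Fin 2 → ℚ_[p]) :
    (mat a b c d *ᵥ w) 0 = (a : ℚ_[p]) * w 0 + (b : ℚ_[p]) * w 1 := by
  simp [mat, Matrix.mulVec, dotProduct, Fin.sum_univ_two]

/-- `(mat a b c d) w = (a w₀ + b w₁, c w₀ + d w₁)`: second component. [folklore] -/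
theorem mat_mulVec_one (a b c d : ℤ_[p]) (w : Fin 2 → ℚ_[p]) :
    (mat a b c d *ᵥ w) 1 = (c : ℚ_[p]) * w 0 + (d : ℚ_[p]) * w 1 := by
  simp [mat, Matrix.mulVec, dotProduct, Fin.sum_univ_two]

/-- **`((x, y)·M)·w = (x, y)·(M w)`**: the pairing power of the translate is the pairing power at
`M w`. [folklore] -/
theorem pairPow_linMap (n : ℕ) (a b c d : ℤ_[p]) (w : Fin 2 → ℚ_[p]) (v : ℤ_[p] × ℤ_[p]) :
    pairPow n w (linMap a b c d v) = pairPow n (mat a b c d *ᵥ w) v := by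
  rw [pairPow_apply, pairPow_apply, linMap_apply, mat_mulVec_zero, mat_mulVec_one]
  push_cast
  ring

end PairPow

/-! ### The weight-`n` specialisation and its equivariance -/

namespace BoundedDistribution

variable (D : BoundedDistribution (padicIntSq p) ℚ_[p])

/-- **The weight-`n` specialisation** of a bounded distribution on `ℤ_p × ℤ_p`: the coefficient
vector `i ↦ C(n, i) ∫ x^{n-i} yⁱ dD` of the binary form `w ↦ ∫ (x w₀ + y w₁)ⁿ dD(x, y)`
(Greenberg–Stevens 1993, (1.4), (4.6)). [cite: GreenbergStevens1993, §4 (4.6)] -/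
def specialize (n : ℕ) : Fin (n + 1) → ℚ_[p] := fun i =>
  (n.choose i : ℚ_[p]) * D.integral fun v => (v.1 : ℚ_[p]) ^ (n - i) * (v.2 : ℚ_[p]) ^ (i : ℕ)

/-- Unfolding lemma for `specialize`. [folklore] -/
theorem specialize_apply (n : ℕ) (i : Fin (n + 1)) :
    D.specialize n i =
      (n.choose i : ℚ_[p]) * D.integral fun v => (v.1 : ℚ_[p]) ^ (n - i) * (v.2 : ℚ_[p]) ^ (i : ℕ) :=
  rfl

/-- **The specialisation is the form `w ↦ ∫ (x w₀ + y w₁)ⁿ dD`**: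
`evalVec n (D.specialize n) w = ∫ pairPow n w dD` (binomial theorem under the integral sign).
[folklore] -/
theorem evalVec_specialize (n : ℕ) (w : Fin 2 → ℚ_[p]) :
    ModularForms.HidaCohomology.evalVec n (D.specialize n) w = D.integral (pairPow n w) := by
  -- the binomial expansion of the pairing power, term by term uniformly continuous
  set g : ℕ → (ℤ_[p] × ℤ_[p] → ℚ_[p]) := fun m v =>
    ((v.2 : ℚ_[p]) * w 1) ^ m * ((v.1 : ℚ_[p]) * w 0) ^ (n - m) * (n.choose m : ℚ_[p]) with hg
  have hterm : ∀ m : ℕ, UniformContinuous (g m) := fun m =>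
    CompactSpace.uniformContinuous_of_continuous (by simp only [hg]; fun_prop)
  have hexp : pairPow (p := p) n w = fun v => ∑ m ∈ Finset.range (n + 1), g m v := by
    funext v
    rw [pairPow_apply, add_comm, add_pow]
  rw [hexp, D.integral_finset_sum _ fun m _ => hterm m, ModularForms.HidaCohomology.evalVec]
  -- both sides are `Σ_{m ≤ n} C(n,m) w₀^{n-m} w₁^m ∫ x^{n-m} y^m dD`
  have hcoef : ∀ i : Fin (n + 1),
      D.specialize n i * w 0 ^ (n - (i : ℕ)) * w 1 ^ (i : ℕ) = D.integral (g i) := by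
    intro i
    have h1 : UniformContinuous fun v : ℤ_[p] × ℤ_[p] =>
        (n.choose i : ℚ_[p]) * ((v.1 : ℚ_[p]) ^ (n - (i : ℕ)) * (v.2 : ℚ_[p]) ^ (i : ℕ)) :=
      CompactSpace.uniformContinuous_of_continuous (by fun_prop)
    have h2 : UniformContinuous fun v : ℤ_[p] × ℤ_[p] =>
        (n.choose i : ℚ_[p]) * ((v.1 : ℚ_[p]) ^ (n - (i : ℕ)) * (v.2 : ℚ_[p]) ^ (i : ℕ)) *
          w 0 ^ (n - (i : ℕ)) :=
      CompactSpace.uniformContinuous_of_continuous (by fun_prop)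
    rw [specialize_apply, ← D.integral_const_mul _ (uniformContinuous_coe_monomial _ _),
      ← D.integral_mul_const _ h1, ← D.integral_mul_const _ h2]
    refine congr_arg D.integral (funext fun v => ?_)
    simp only [hg, mul_pow]
    ring
  rw [Finset.sum_congr rfl fun i _ => hcoef i]
  exact Fin.sum_univ_eq_sum_range (fun m => D.integral (g m)) (n + 1)

/-- **Equivariance of the specialisation, functional form**:
`evalVec n ((D·M).specialize n) w = evalVec n (D.specialize n) (M w)`
(change of variables `integral_linearMap` and `((x, y)·M)·w = (x, y)·(M w)`).
[cite: GreenbergStevens1993, §4 (4.6)–(4.8)] -/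
theorem evalVec_specialize_linearMap (n : ℕ) (a b c d : ℤ_[p]) (w : Fin 2 → ℚ_[p]) :
    ModularForms.HidaCohomology.evalVec n ((D.linearMap a b c d).specialize n) w =
      ModularForms.HidaCohomology.evalVec n (D.specialize n) (mat a b c d *ᵥ w) := by
  rw [evalVec_specialize, evalVec_specialize, D.integral_linearMap a b c d (uniformContinuous_pairPow n w)]
  exact congr_arg D.integral (funext fun v => pairPow_linMap n a b c d w v)

/-- Coefficient vectors of binary forms over `ℚ_p` are determined by the form as a function.
[folklore] -/
theorem eq_of_evalVec_eq {n : ℕ} {x y : Fin (n + 1) → ℚ_[p]}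
    (h : ∀ w : Fin 2 → ℚ_[p], ModularForms.HidaCohomology.evalVec n x w = ModularForms.HidaCohomology.evalVec n y w) : x = y := by
  apply ModularForms.HidaCohomology.toPoly_injective
  apply MvPolynomial.funext
  intro w
  rw [← ModularForms.HidaCohomology.evalVec_eq_eval, ← ModularForms.HidaCohomology.evalVec_eq_eval, h w]

/-- **Equivariance of the specialisation**: `(D·M).specialize n = Symⁿ(M) · D.specialize n` with the
symmetric-power matrices of `HidaOrdinaryCohomologySymPow` — the weight-`n` specialisation
`𝔻 → Symⁿ` is a morphism of right `M₂(ℤ_p)`-modules (Greenberg–Stevens 1993, (4.6)–(4.8)).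
[cite: GreenbergStevens1993, §4 (4.6)–(4.8)] -/
theorem specialize_linearMap (n : ℕ) (a b c d : ℤ_[p]) :
    (D.linearMap a b c d).specialize n = ModularForms.HidaCohomology.symPow n (mat a b c d) *ᵥ D.specialize n :=
  eq_of_evalVec_eq fun w => by
    rw [evalVec_specialize_linearMap, ModularForms.HidaCohomology.evalVec_symPow_mulVec]

/-- The matrix of an integer matrix `M`: `mat (M₀₀) (M₀₁) (M₁₀) (M₁₁) = M.map (Int.cast)`. [folklore] -/
theorem mat_intCast (M : Matrix (Fin 2) (Fin 2) ℤ) :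
    mat (p := p) (M 0 0) (M 0 1) (M 1 0) (M 1 1) = M.map (Int.castRingHom ℚ_[p]) := by
  ext i j
  fin_cases i <;> fin_cases j <;> simp [mat]

/-- **Equivariance for integer matrices**, in the form of the right action `a ↦ Symⁿ(M) a` on the
coefficient modules of `HidaOrdinaryCohomologyCocycles` (`act n M a = symPow n (M.map Int.cast) *ᵥ a`):
`(D·M).specialize n = symPow n (M.map Int.cast) *ᵥ D.specialize n`. [folklore] -/
theorem specialize_linearMap_intCast (n : ℕ) (M : Matrix (Fin 2) (Fin 2) ℤ) :
    (D.linearMap (M 0 0) (M 0 1) (M 1 0) (M 1 1)).specialize n =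
      ModularForms.HidaCohomology.symPow n (M.map (Int.castRingHom ℚ_[p])) *ᵥ D.specialize n := by
  rw [specialize_linearMap, mat_intCast]

end BoundedDistribution

end Literature.NumberTheory.EllipticCurves

end
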